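import Summits.BirchSwinnertonDyer.BirchSwinnertonDyer.Theorems.KimAtThreeDeepLowerSmallDefect
import Summits.BirchSwinnertonDyer.Rank1Residual.Partition.Bsdp
import HarnessLib

/-!
# Route `KimAtThreeKolyvagin` (rung W2), crux `DeepLowerAtThree` (item 19075) on its NON-ADDITIVE
# tower rows: good ordinary `3` (Yan–Zhu 2026 by name) and multiplicative `3` with (ram) (Skinner 2016
# by name) — outright when `3 ∤ ∏ c_ℓ`, else modulo Tamagawa divisibility

Cell `bsd-addord`, seat `bsd-addord-w2-c2` (D-0074 row B5, gen 2), item `stmt-BirchSwinnertonDyer-19075`.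
The crux quantifies over EVERY `E/ℚ` with the `3`-adic tower onto — no reduction hypothesis at `3` —
while the route's leaf `N11.KimAtThreeRankZeroPUB` is consumed on the ADDITIVE class N11 and every typed
Kolyvagin-system port of the cell (`KatoKuriharaPortThreeAtWith₂`, …) carries `Addv W 3`. This file
records what the tree ALREADY gives on the complementary, non-additive tower rows, through the
BSD-currency placement of `KimAtThreeDeepLowerSmallDefect` (p426576: at a period-transfer row, Miller's
lower half `MissingLowerBoundAt W 3` and «Tamagawa divisibility» `v₃(∏ c_ℓ) ≤ ∂^{(∞)}_{deep}(δ̃)` give the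
crux's conclusion; the lower half alone when `3 ∤ ∏ c_ℓ`):

* §1 `BSD(E,3)` ⟹ the lower half (`missingPPartAt_of_bsdp`, `lower_and_upper_of_missingPPartAt`) ⟹ the
  crux's conclusion at the row (two forms).
* §2 GOOD ORDINARY `3`: the partition row C16 (`RowC16 W 3`: `p = 3`, good ordinary, `E[3]` irreducible,
  surj(3) — all from the tower) gives `BSDp W 3` from the named facts Yan–Zhu 2026 Thm. 4.15 (`hYZ`,
  PUB*, flag `YZ26@3-BF-ERL-Ohta`), Wuthrich 2014 Lemma 20 (`hW20`), modularity (`hmod`), GZK (`hGZK`)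
  (`RowC16.bsdp`); hence the crux on the good-ordinary tower rows: OUTRIGHT when `3 ∤ ∏ c_ℓ`
  (`deepLowerAtThree_row_goodOrd_of_yanZhu_of_not_three_dvd_tamagawa`), else modulo Tamagawa
  divisibility (`…_of_tamagawa_le_deepInfty`).
* §3 MULTIPLICATIVE `3` with Skinner's (ram) witness (`Ram W 3`: a prime `ℓ ≠ 3`, `ℓ ‖ N`, with
  `3 ∤ ord_ℓ Δ`): row C1 (`RowC1 W 3`, rank `0`) gives `BSDp W 3` from Skinner 2016 Thm. C (`hSk`),
  `hmod`, `hGZK` (`RowC1.bsdp`); hence the crux on those rows in the same two forms.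

HONEST FRAMING. Theorems only; every printed input is a hypothesis BY NAME; nothing asserted, nothing
booked; the crux stays open. NOT covered here (no `BSD(E,3)` in the tree): good SUPERSINGULAR `3`
(corners X6/X8), multiplicative `3` without (ram) (corner X11a at `3`), and — on every row — the
Tamagawa-divisible case `3 ∣ ∏ c_ℓ` beyond the displayed inequality `v₃(∏ c_ℓ) ≤ ∂^{(∞)}_{deep}`.

References: [YanZhu2024MainConjNonCM] Thm. 4.15; [Wuthrich2014] Lemma 20; [Skinner2016PacificMC] Thm. C;
[Miller2011LMS] Def. 1.1; [Kim2022StructureSelmer] §1.5.1, Conj. 1.10, Thm. 1.9 (6); [Kim2025RefinedTNC] Thm. 1.1.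
-/

set_option autoImplicit false
-- the Theorems namespace of a single-conjunct summit repeats the summit name by design (D-0017)
set_option linter.dupNamespace false

noncomputable section

open scoped MatrixGroups ModularForm Classical

open CongruenceSubgroup WeierstrassCurve Literature.NumberTheory.EllipticCurves
  Literature.NumberTheory.EllipticCurves.ModularForms
  Literature.NumberTheory.EllipticCurves.Rank1Residual
  Literature.NumberTheory.EllipticCurves.Rank1Residual.Typed

namespace Summit.BirchSwinnertonDyer.BirchSwinnertonDyer.Theorems.KimAtThreeDeepLowerNonAdditiveRows

open Summit.BirchSwinnertonDyer.Rank1Residual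
open Summit.BirchSwinnertonDyer.BirchSwinnertonDyer.Theses.KimAtThreeKolyvagin
open Summit.BirchSwinnertonDyer.BirchSwinnertonDyer.Theorems.KimAtThreeKolyvaginUnitLevelOneRungs
open Summit.BirchSwinnertonDyer.BirchSwinnertonDyer.Theorems.KimAtThreeDeepLowerSmallDefect

/-! ### §1 One row: from `BSD(E,3)` (any reduction type at `3`) -/

section Row

variable (W : WeierstrassCurve ℚ) [W.IsElliptic] [W.IsGloballyMinimal]
  {N : ℕ} [NeZero N] (f : CuspForm (Gamma0 N) 2)

/-- On a row with `ord(δ̃) = 0` the analytic rank is `0` (`L(E,1) = [0]⁺_f·Ω⁺_f ≠ 0`).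
[cite: Kim2022StructureSelmer, §1.4.3–1.4.4 (PDF p. 7)] -/
theorem analyticRank_eq_zero_of_kuriharaVanishingOrder_eq_zero (hf : IsNewformOf W f)
    (hord : kuriharaVanishingOrder W 3 f = 0) : W.analyticRank = 0 :=
  analyticRank_eq_zero_of_entireLFunction_one_ne_zero
    (hf.entireLFunction_one_ne_zero_of_ratPlusSymbol_zero_ne_zero
      (ratPlusSymbol_zero_ne_zero_of_kuriharaVanishingOrder_eq_zero W 3 f hord))

/-- **`BSD(E,3)` at a tower row of analytic rank `0` with the `3`-adic period transfer ⟹ crux 19075's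
conclusion, modulo «Tamagawa divisibility» `v₃(∏ c_ℓ) ≤ ∂^{(∞)}_{deep}(δ̃)`** (Miller's `BSDp W 3` gives
the lower half; then p426576's `deepLower_conclusion_of_missingLowerBoundAt_of_tamagawa_le_deepInfty`).
[cite: Miller2011LMS, Def. 1.1] [cite: Kim2022StructureSelmer, Conj. 1.10 (PDF p. 8), Thm. 1.9 (6)] -/
theorem deepLower_conclusion_three_of_bsdp_of_tamagawa_le_deepInfty
    (hGZK : rank_eq_analyticRank_of_analyticRank_le_one)
    (htower : ∀ n : ℕ, W.HasSurjectiveModNGaloisRep (3 ^ n : ℕ)) (hfin : Finite W.sha)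
    (hf : IsNewformOf W f) (hord : kuriharaVanishingOrder W 3 f = 0)
    (hper : ∃ u : ℚ, ‖(u : ℚ_[3])‖ = 1 ∧ W.realPeriodRat = u * plusPeriod f)
    (hbsd : haveI : Fact (Nat.Prime 3) := ⟨Nat.prime_three⟩; BSDp W 3)
    (htam : ((padicValNat 3 W.tamagawaProduct : ℕ) : ℕ∞) ≤ kuriharaPartialDeepInfty W 3 f) :
    ∃ d : ℕ, kuriharaPartialDeepInfty W 3 f = d ∧
      kuriharaPartial W 3 f 0 ≤
        ((padicValNat 3 (Nat.card (AddCommGroup.primaryComponent W.sha 3)) + d : ℕ) : ℕ∞) := by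
  haveI : Fact (Nat.Prime 3) := ⟨Nat.prime_three⟩
  haveI : Finite W.sha := hfin
  exact deepLower_conclusion_of_missingLowerBoundAt_of_tamagawa_le_deepInfty W 3 f hGZK (by norm_num)
    (hasIrreducibleModPGaloisRep_of_hasSurjectiveModNGaloisRep W 3 (by simpa using htower 1))
    hf hord hper (lower_and_upper_of_missingPPartAt W 3 (missingPPartAt_of_bsdp W 3 hbsd)).1 htam

/-- **… and OUTRIGHT when `3 ∤ ∏ c_ℓ`.** [cite: Miller2011LMS, Def. 1.1] [cite: Kim2022StructureSelmer, Thm. 1.9 (6)] -/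
theorem deepLower_conclusion_three_of_bsdp_of_not_three_dvd_tamagawa
    (hGZK : rank_eq_analyticRank_of_analyticRank_le_one)
    (htower : ∀ n : ℕ, W.HasSurjectiveModNGaloisRep (3 ^ n : ℕ)) (hfin : Finite W.sha)
    (hf : IsNewformOf W f) (hord : kuriharaVanishingOrder W 3 f = 0)
    (hper : ∃ u : ℚ, ‖(u : ℚ_[3])‖ = 1 ∧ W.realPeriodRat = u * plusPeriod f)
    (hbsd : haveI : Fact (Nat.Prime 3) := ⟨Nat.prime_three⟩; BSDp W 3)
    (htam : ¬ 3 ∣ W.tamagawaProduct) :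
    ∃ d : ℕ, kuriharaPartialDeepInfty W 3 f = d ∧
      kuriharaPartial W 3 f 0 ≤
        ((padicValNat 3 (Nat.card (AddCommGroup.primaryComponent W.sha 3)) + d : ℕ) : ℕ∞) := by
  haveI : Fact (Nat.Prime 3) := ⟨Nat.prime_three⟩
  refine deepLower_conclusion_three_of_bsdp_of_tamagawa_le_deepInfty W f hGZK htower hfin hf hord hper
    hbsd ?_
  rw [padicValNat.eq_zero_of_not_dvd htam, Nat.cast_zero]
  exact zero_le

end Row

/-! ### §2 GOOD ORDINARY `3` tower rows: `BSD(E,3)` from Yan–Zhu 2026 Thm. 4.15 by name (row C16) -/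

/-- **Crux 19075 on the good-ordinary-`3` tower rows, modulo Tamagawa divisibility** — crux binders
verbatim, then: good ordinary reduction at `3` (`3 ∤ N`, `3 ∤ a₃`), the `3`-adic period transfer, and
`v₃(∏ c_ℓ) ≤ ∂^{(∞)}_{deep}(δ̃)`; named facts Yan–Zhu 2026 Thm. 4.15 (`hYZ`), Wuthrich 2014 Lemma 20
(`hW20`), modularity (`hmod`), GZK (`hGZK`). The tower gives `E[3]` irreducible and surj(3), so the row
is the partition's row C16 and `RowC16.bsdp` yields `BSDp W 3`. [cite: YanZhu2024MainConjNonCM, Thm. 4.15 (§4.6)]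
[cite: Wuthrich2014, Lemma 20 (p. 399)] [cite: Kim2022StructureSelmer, Conj. 1.10 (PDF p. 8)] -/
theorem deepLowerAtThree_row_goodOrd_of_yanZhu_of_tamagawa_le_deepInfty
    (hYZ : YanZhu2026.thm415_padicValRat_bsd_rank_le_one)
    (hW20 : Wuthrich2014.lemma20_surjective_threeAdic_of_semistable)
    (hmod : hasEntireLFunction_rat) (hGZK : rank_eq_analyticRank_of_analyticRank_le_one) :
    ∀ (W : WeierstrassCurve ℚ) [W.IsElliptic] [W.IsGloballyMinimal],
      (∀ n : ℕ, W.HasSurjectiveModNGaloisRep (3 ^ n : ℕ)) →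
      Finite W.sha →
      ∀ {N : ℕ} [NeZero N] (f : CuspForm (Gamma0 N) 2), IsNewformOf W f →
      (∀ r : ℚ, ratPlusSymbol f r ≠ 0 → 0 ≤ padicValRat 3 (ratPlusSymbol f r)) →
      kuriharaVanishingOrder W 3 f = 0 →
      W.HasGoodReductionAtPrime 3 → ¬ (3 : ℤ) ∣ W.frobeniusTrace 3 →
      (∃ u : ℚ, ‖(u : ℚ_[3])‖ = 1 ∧ W.realPeriodRat = u * plusPeriod f) →
      ((padicValNat 3 W.tamagawaProduct : ℕ) : ℕ∞) ≤ kuriharaPartialDeepInfty W 3 f →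
        ∃ d : ℕ, kuriharaPartialDeepInfty W 3 f = d ∧
          kuriharaPartial W 3 f 0 ≤
            ((padicValNat 3 (Nat.card (AddCommGroup.primaryComponent W.sha 3)) + d : ℕ) : ℕ∞) := by
  intro W _ _ htower hfin N _ f hf _ hord hgood hord3 hper htam
  haveI : Fact (Nat.Prime 3) := ⟨Nat.prime_three⟩
  have hsurj : Surj W 3 := by
    have h := htower 1
    rw [pow_one] at h
    exact h
  have hirr : Irr W 3 := hasIrreducibleModPGaloisRep_of_hasSurjectiveModNGaloisRep W 3 hsurj
  have hr0 := analyticRank_eq_zero_of_kuriharaVanishingOrder_eq_zero W f hf hord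
  have hC16 : RowC16 W 3 := ⟨rfl, ⟨hgood, by exact_mod_cast hord3⟩, hirr, Or.inl hsurj⟩
  have hbsd : BSDp W 3 := RowC16.bsdp hYZ hW20 hmod hGZK (by rw [hr0]; exact zero_le_one) hC16
  exact deepLower_conclusion_three_of_bsdp_of_tamagawa_le_deepInfty W f hGZK htower hfin hf hord hper
    hbsd htam

/-- **Crux 19075 OUTRIGHT (modulo the named PUB facts) on the good-ordinary-`3` tower rows with
`3 ∤ ∏ c_ℓ`** (unit period transfer). [cite: YanZhu2024MainConjNonCM, Thm. 4.15 (§4.6)]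
[cite: Wuthrich2014, Lemma 20 (p. 399)] [cite: Kim2022StructureSelmer, Thm. 1.9 (6)] -/
theorem deepLowerAtThree_row_goodOrd_of_yanZhu_of_not_three_dvd_tamagawa
    (hYZ : YanZhu2026.thm415_padicValRat_bsd_rank_le_one)
    (hW20 : Wuthrich2014.lemma20_surjective_threeAdic_of_semistable)
    (hmod : hasEntireLFunction_rat) (hGZK : rank_eq_analyticRank_of_analyticRank_le_one) :
    ∀ (W : WeierstrassCurve ℚ) [W.IsElliptic] [W.IsGloballyMinimal],
      (∀ n : ℕ, W.HasSurjectiveModNGaloisRep (3 ^ n : ℕ)) →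
      Finite W.sha →
      ∀ {N : ℕ} [NeZero N] (f : CuspForm (Gamma0 N) 2), IsNewformOf W f →
      (∀ r : ℚ, ratPlusSymbol f r ≠ 0 → 0 ≤ padicValRat 3 (ratPlusSymbol f r)) →
      kuriharaVanishingOrder W 3 f = 0 →
      W.HasGoodReductionAtPrime 3 → ¬ (3 : ℤ) ∣ W.frobeniusTrace 3 →
      (∃ u : ℚ, ‖(u : ℚ_[3])‖ = 1 ∧ W.realPeriodRat = u * plusPeriod f) →
      ¬ 3 ∣ W.tamagawaProduct →
        ∃ d : ℕ, kuriharaPartialDeepInfty W 3 f = d ∧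
          kuriharaPartial W 3 f 0 ≤
            ((padicValNat 3 (Nat.card (AddCommGroup.primaryComponent W.sha 3)) + d : ℕ) : ℕ∞) := by
  intro W _ _ htower hfin N _ f hf hint hord hgood hord3 hper htam
  haveI : Fact (Nat.Prime 3) := ⟨Nat.prime_three⟩
  refine deepLowerAtThree_row_goodOrd_of_yanZhu_of_tamagawa_le_deepInfty hYZ hW20 hmod hGZK W htower
    hfin f hf hint hord hgood hord3 hper ?_
  rw [padicValNat.eq_zero_of_not_dvd htam, Nat.cast_zero]
  exact zero_le

/-! ### §3 MULTIPLICATIVE `3` tower rows with (ram): `BSD(E,3)` from Skinner 2016 Thm. C by name (row C1) -/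

/-- **Crux 19075 on the multiplicative-`3` tower rows with Skinner's (ram) witness, modulo Tamagawa
divisibility** — crux binders verbatim, then: multiplicative reduction at `3`, `Ram W 3` (a prime
`ℓ ≠ 3` of multiplicative reduction with `3 ∤ ord_ℓ Δ_E`), the period transfer and
`v₃(∏ c_ℓ) ≤ ∂^{(∞)}_{deep}(δ̃)`; named facts Skinner 2016 Thm. C (`hSk`), `hmod`, `hGZK` — the row is
row C1 (rank `0`, `p = 3 ≥ 3`, multiplicative, irreducible, (ram)) and `RowC1.bsdp` gives `BSDp W 3`.
[cite: Skinner2016PacificMC, Thm. C (§1)] [cite: Kim2022StructureSelmer, Conj. 1.10 (PDF p. 8)] -/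
theorem deepLowerAtThree_row_mult_of_skinner_of_tamagawa_le_deepInfty
    (hSk : Skinner2016.thmC_padicValRat_bsd_rank_zero)
    (hmod : hasEntireLFunction_rat) (hGZK : rank_eq_analyticRank_of_analyticRank_le_one) :
    ∀ (W : WeierstrassCurve ℚ) [W.IsElliptic] [W.IsGloballyMinimal],
      (∀ n : ℕ, W.HasSurjectiveModNGaloisRep (3 ^ n : ℕ)) →
      Finite W.sha →
      ∀ {N : ℕ} [NeZero N] (f : CuspForm (Gamma0 N) 2), IsNewformOf W f →
      (∀ r : ℚ, ratPlusSymbol f r ≠ 0 → 0 ≤ padicValRat 3 (ratPlusSymbol f r)) →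
      kuriharaVanishingOrder W 3 f = 0 →
      W.HasMultiplicativeReductionAtPrime 3 →
      (haveI : Fact (Nat.Prime 3) := ⟨Nat.prime_three⟩; Ram W 3) →
      (∃ u : ℚ, ‖(u : ℚ_[3])‖ = 1 ∧ W.realPeriodRat = u * plusPeriod f) →
      ((padicValNat 3 W.tamagawaProduct : ℕ) : ℕ∞) ≤ kuriharaPartialDeepInfty W 3 f →
        ∃ d : ℕ, kuriharaPartialDeepInfty W 3 f = d ∧
          kuriharaPartial W 3 f 0 ≤
            ((padicValNat 3 (Nat.card (AddCommGroup.primaryComponent W.sha 3)) + d : ℕ) : ℕ∞) := by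
  intro W _ _ htower hfin N _ f hf _ hord hmult hram hper htam
  haveI : Fact (Nat.Prime 3) := ⟨Nat.prime_three⟩
  have hsurj : Surj W 3 := by
    have h := htower 1
    rw [pow_one] at h
    exact h
  have hirr : Irr W 3 := hasIrreducibleModPGaloisRep_of_hasSurjectiveModNGaloisRep W 3 hsurj
  have hr0 := analyticRank_eq_zero_of_kuriharaVanishingOrder_eq_zero W f hf hord
  have hC1 : RowC1 W 3 := ⟨hr0, le_rfl, Or.inr hmult, hirr, hram⟩
  have hbsd : BSDp W 3 := RowC1.bsdp hSk hmod hGZK hC1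
  exact deepLower_conclusion_three_of_bsdp_of_tamagawa_le_deepInfty W f hGZK htower hfin hf hord hper
    hbsd htam

/-- **Crux 19075 OUTRIGHT (modulo the named PUB facts) on the multiplicative-`3` tower rows with (ram)
and `3 ∤ ∏ c_ℓ`** (unit period transfer). [cite: Skinner2016PacificMC, Thm. C (§1)]
[cite: Kim2022StructureSelmer, Thm. 1.9 (6)] -/
theorem deepLowerAtThree_row_mult_of_skinner_of_not_three_dvd_tamagawa
    (hSk : Skinner2016.thmC_padicValRat_bsd_rank_zero)
    (hmod : hasEntireLFunction_rat) (hGZK : rank_eq_analyticRank_of_analyticRank_le_one) :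
    ∀ (W : WeierstrassCurve ℚ) [W.IsElliptic] [W.IsGloballyMinimal],
      (∀ n : ℕ, W.HasSurjectiveModNGaloisRep (3 ^ n : ℕ)) →
      Finite W.sha →
      ∀ {N : ℕ} [NeZero N] (f : CuspForm (Gamma0 N) 2), IsNewformOf W f →
      (∀ r : ℚ, ratPlusSymbol f r ≠ 0 → 0 ≤ padicValRat 3 (ratPlusSymbol f r)) →
      kuriharaVanishingOrder W 3 f = 0 →
      W.HasMultiplicativeReductionAtPrime 3 →
      (haveI : Fact (Nat.Prime 3) := ⟨Nat.prime_three⟩; Ram W 3) →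
      (∃ u : ℚ, ‖(u : ℚ_[3])‖ = 1 ∧ W.realPeriodRat = u * plusPeriod f) →
      ¬ 3 ∣ W.tamagawaProduct →
        ∃ d : ℕ, kuriharaPartialDeepInfty W 3 f = d ∧
          kuriharaPartial W 3 f 0 ≤
            ((padicValNat 3 (Nat.card (AddCommGroup.primaryComponent W.sha 3)) + d : ℕ) : ℕ∞) := by
  intro W _ _ htower hfin N _ f hf hint hord hmult hram hper htam
  haveI : Fact (Nat.Prime 3) := ⟨Nat.prime_three⟩
  refine deepLowerAtThree_row_mult_of_skinner_of_tamagawa_le_deepInfty hSk hmod hGZK W htower hfin f hf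
    hint hord hmult hram hper ?_
  rw [padicValNat.eq_zero_of_not_dvd htam, Nat.cast_zero]
  exact zero_le

end Summit.BirchSwinnertonDyer.BirchSwinnertonDyer.Theorems.KimAtThreeDeepLowerNonAdditiveRows

end
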